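import Literature.RingTheory.SimpleModule.CentralCharacterIsotypicPrimitive
import HarnessLib

/-!
# The central character along a block field: an anti-multiplicative map into the centre acts on a simple module through a
# RING HOMOMORPHISM, and its eigenvectors lie in the isotypic component

Topic `RingTheory/SimpleModule`; namespace `Literature.RingTheory.SimpleModule`.  THEOREMS ONLY (no definition, no named fact, no
instance, no `sorry`); Mathlib + ★ `CentralCharacterIsotypic` + ★ `CentralCharacterIsotypicPrimitive`.

Setting ([Lam2001FirstCourse] §3 (3.5)/(3.8), §22 (22.1); [BourbakiAlgebreVIII2012] §3 no. 2, §5 no. 1).  `R` an algebra over a field `L`,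
`M` an `R`-module, `N ≤ M` a SIMPLE submodule, and `a : R₀ →+ R` an additive map from a (semi)ring `R₀` which is ANTI-multiplicative
(`a (r s) = a s · a r` — the shape of a multiplicative map followed by a contravariant realisation, e.g. the transpose), takes CENTRAL
values, and whose value `a 1` (a central idempotent, not necessarily `1`) acts as the identity on `N`.  The example in view (cell
`hodgecm-mathlib`, d6 S2′ socket `SocketIso`): `R = ℚ̄_ℓ[Hecke operators on ℚ̄_ℓ ⊗ H¹_ét(A_K)]`, `R₀` the block field `Z(heckeImage K)·ε` of
an irreducible constituent, `a = (ᵗV_ℓ^ℚ(·) ⊗ 1) ∘ φ`, `N = N₀` the level-`K` classes under `f′(ω^K)`.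

* §1 `exists_ringHom_forall_smul_eq` (`L` ALGEBRAICALLY CLOSED, `M` finite-dimensional): there is a ring homomorphism `τ : R₀ →+* L`
  with `a r • n = τ r • n` on `N` — Schur's lemma (★ `exists_algHom_forall_center_smul_eq`: the centre acts on the finite-dimensional
  simple `N` through an `L`-algebra map `χ : Z(R) → L`) composed with `a`; `τ 1 = 1` because `a 1` fixes `N ≠ 0`, and `τ` is
  multiplicative although `a` is anti-multiplicative because `L` is commutative.
* §2 `mem_isotypicComponent_of_forall_smul_eq_smul` (`R` SEMISIMPLE): if moreover every central `z` with `z · a 1 = z` lies in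
  `span_L (range a)` (e.g. `range a` is the whole block `Z(R)·a 1` of the centre), then every `m ∈ M` on which each `a r` acts by the
  same scalar as on `N` lies in the `N`-isotypic component of `M` (★ `mem_isotypicComponent_of_forall_smul_eq` with `Z₀ = range a`,
  `ε = a 1`).
* §3 `exists_ringHom_forall_smul_eq_and_forall_mem_isotypicComponent` — both together: the character `τ` of `N` along `a`, and
  «`τ`-eigenvectors of `a(R₀)` are `N`-isotypic».

Count-neutral support file (HC_CM is proved only modulo the 7 printed citations until rung 0 closes).

## References
* [Lam2001FirstCourse] T. Y. Lam, *A First Course in Noncommutative Rings*, 2nd ed., GTM 131 (2001): §3 Thm. (3.5) (pp. 33–35), Lemma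
  (3.8) (p. 35); §22 Prop. (22.1) (p. 327).
* [BourbakiAlgebreVIII2012] N. Bourbaki, *Algèbre*, Ch. VIII (2012), §3 no. 2 (lemme de Schur), §4 no. 6, §5 no. 1.
-/

set_option autoImplicit false

namespace Literature.RingTheory.SimpleModule

variable {L : Type*} [Field L] {R : Type*} [Ring R] [Algebra L R]
  {M : Type*} [AddCommGroup M] [Module R M] [Module L M] [IsScalarTower L R M]
  {R₀ : Type*} [NonAssocSemiring R₀]

/-! ## §1 The character along `a` is a ring homomorphism (Schur) -/

/-- **Schur along a block field.**  `L` algebraically closed, `M` finite-dimensional over `L`, `N ≤ M` a simple `R`-submodule,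
`a : R₀ →+ R` additive, ANTI-multiplicative, with central values, `a 1` acting as `1` on `N`.  Then there is a ring homomorphism
`τ : R₀ →+* L` such that `a r` acts on `N` as the scalar `τ r`. [cite: BourbakiAlgebreVIII2012, §3 no. 2 (lemme de Schur) and §5 no. 1]
[cite: Lam2001FirstCourse, §3 Thm. (3.5) (pp. 33–35) and Lemma (3.8) (p. 35)] -/
theorem exists_ringHom_forall_smul_eq [IsAlgClosed L] [FiniteDimensional L M] (N : Submodule R M) [IsSimpleModule R N]
    (a : R₀ →+ R) (hmul : ∀ r s : R₀, a (r * s) = a s * a r) (hcen : ∀ (r : R₀) (x : R), x * a r = a r * x)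
    (hone : ∀ n ∈ N, a 1 • n = n) :
    ∃ τ : R₀ →+* L, ∀ r : R₀, ∀ n ∈ N, a r • n = τ r • n := by
  haveI : FiniteDimensional L N := Module.Finite.of_injective (N.subtype.restrictScalars L) Subtype.val_injective
  obtain ⟨χ, hχ⟩ := exists_algHom_forall_center_smul_eq (R := R) (S := N) (L := L)
  have hmem : ∀ r : R₀, a r ∈ Subalgebra.center L R := fun r => Subalgebra.mem_center_iff.2 fun x => hcen r x
  -- read scalars off a non-zero vector of `N`
  haveI := IsSimpleModule.nontrivial R N
  obtain ⟨x₀, hx₀⟩ := exists_ne (0 : N)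
  have hinj : ∀ c d : L, c • x₀ = d • x₀ → c = d := fun c d h => smul_left_injective L hx₀ h
  have hval : ∀ r : R₀, (a r) • x₀ = χ ⟨a r, hmem r⟩ • x₀ := fun r => hχ ⟨a r, hmem r⟩ x₀
  refine ⟨{ toFun := fun r => χ ⟨a r, hmem r⟩
            map_one' := ?_
            map_mul' := ?_
            map_zero' := ?_
            map_add' := ?_ }, fun r n hn => ?_⟩
  · -- `a 1` fixes `x₀`, so `χ (a 1) = 1`
    apply hinj
    rw [← hval 1, one_smul]
    exact Subtype.ext (by rw [Submodule.coe_smul]; exact hone _ x₀.2)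
  · intro r s
    have h1 : (⟨a (r * s), hmem (r * s)⟩ : Subalgebra.center L R) = ⟨a s, hmem s⟩ * ⟨a r, hmem r⟩ :=
      Subtype.ext (hmul r s)
    rw [h1, map_mul]
    exact mul_comm _ _
  · have h0 : (⟨a 0, hmem 0⟩ : Subalgebra.center L R) = 0 := Subtype.ext (map_zero a)
    rw [h0, map_zero]
  · intro r s
    have h2 : (⟨a (r + s), hmem (r + s)⟩ : Subalgebra.center L R) = ⟨a r, hmem r⟩ + ⟨a s, hmem s⟩ :=
      Subtype.ext (map_add a r s)
    rw [h2, map_add]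
  · have h := congrArg Subtype.val (hχ ⟨a r, hmem r⟩ ⟨n, hn⟩)
    rw [Submodule.coe_smul, Submodule.coe_smul_of_tower] at h
    exact h

/-! ## §2 `τ`-eigenvectors of `a(R₀)` are `N`-isotypic (semisimple `R`) -/

/-- **Eigenvectors along the block field are isotypic.**  `R` a semisimple `L`-algebra, `N ≤ M` simple, `a : R₀ →+ R` additive and
anti-multiplicative with central values, `a 1` acting as `1` on `N`, each `a r` acting on `N` by the scalar `χ₀ r`, and every central
`z ∈ R` with `z · a 1 = z` lying in `span_L (range a)`.  Then every `m ∈ M` with `a r • m = χ₀ r • m` for all `r` lies in the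
`N`-isotypic component of `M` (★ `mem_isotypicComponent_of_forall_smul_eq` with `Z₀ = range a`, `ε = a 1`).
[cite: Lam2001FirstCourse, §3 Thm. (3.5) (pp. 33–35), Lemma (3.8) (p. 35), §22 Prop. (22.1) (p. 327)] -/
theorem mem_isotypicComponent_of_forall_smul_eq_smul [IsSemisimpleRing R] (N : Submodule R M) [IsSimpleModule R N]
    (a : R₀ →+ R) (hmul : ∀ r s : R₀, a (r * s) = a s * a r) (hcen : ∀ (r : R₀) (x : R), x * a r = a r * x)
    (hone : ∀ n ∈ N, a 1 • n = n) (χ₀ : R₀ → L) (hN : ∀ r : R₀, ∀ n ∈ N, a r • n = χ₀ r • n)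
    (hZ : ∀ z : R, (∀ x : R, z * x = x * z) → z * a 1 = z → z ∈ Submodule.span L (Set.range a))
    {m : M} (hm : ∀ r : R₀, a r • m = χ₀ r • m) : m ∈ isotypicComponent R M N := by
  classical
  have hidem : IsIdempotentElem (a 1) := by
    change a 1 * a 1 = a 1
    rw [← hmul, one_mul]
  -- extend `χ₀` along `a` to a function on `R` (any choice of preimage gives the same scalar action)
  refine mem_isotypicComponent_of_forall_smul_eq (L := L) N (Set.range a)
    (fun z => if h : ∃ r, a r = z then χ₀ h.choose else 0) ?_ hidem (fun x => (hcen 1 x).symm) hone hZ ?_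
  · rintro _ ⟨r, rfl⟩ n hn
    have h : ∃ r', a r' = a r := ⟨r, rfl⟩
    rw [dif_pos h]
    calc a r • n = a h.choose • n := by rw [h.choose_spec]
      _ = χ₀ h.choose • n := hN _ n hn
  · rintro _ ⟨r, rfl⟩
    have h : ∃ r', a r' = a r := ⟨r, rfl⟩
    rw [dif_pos h]
    calc a r • m = a h.choose • m := by rw [h.choose_spec]
      _ = χ₀ h.choose • m := hm _

/-! ## §3 Both together -/

/-- **The character of a simple module along a block field, and its eigenvectors.**  `L` algebraically closed, `R` a semisimple
`L`-algebra, `M` finite-dimensional, `N ≤ M` simple, `a : R₀ →+ R` additive and anti-multiplicative with central values, `a 1 = 1` on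
`N`, every central `z` with `z · a 1 = z` in `span_L (range a)`.  Then there is a ring homomorphism `τ : R₀ →+* L` with `a r = τ r` on
`N`, and every `m` with `a r • m = τ r • m` for all `r` lies in `isotypicComponent R M N`.
[cite: BourbakiAlgebreVIII2012, §3 no. 2 and §5 no. 1] [cite: Lam2001FirstCourse, §3 Thm. (3.5) (pp. 33–35), §22 Prop. (22.1) (p. 327)] -/
theorem exists_ringHom_forall_smul_eq_and_forall_mem_isotypicComponent [IsAlgClosed L] [FiniteDimensional L M] [IsSemisimpleRing R]
    (N : Submodule R M) [IsSimpleModule R N]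
    (a : R₀ →+ R) (hmul : ∀ r s : R₀, a (r * s) = a s * a r) (hcen : ∀ (r : R₀) (x : R), x * a r = a r * x)
    (hone : ∀ n ∈ N, a 1 • n = n)
    (hZ : ∀ z : R, (∀ x : R, z * x = x * z) → z * a 1 = z → z ∈ Submodule.span L (Set.range a)) :
    ∃ τ : R₀ →+* L, (∀ r : R₀, ∀ n ∈ N, a r • n = τ r • n) ∧
      ∀ m : M, (∀ r : R₀, a r • m = τ r • m) → m ∈ isotypicComponent R M N := by
  obtain ⟨τ, hτ⟩ := exists_ringHom_forall_smul_eq (L := L) N a hmul hcen hone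
  exact ⟨τ, hτ, fun m hm => mem_isotypicComponent_of_forall_smul_eq_smul N a hmul hcen hone τ hτ hZ hm⟩

end Literature.RingTheory.SimpleModule
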